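import Summits.Parity.GeneralizedHardyLittlewood.Theorems.LeeYangFibresCellParityLawKernelInductionAux
import HarnessLib

/-!
# Route `LeeYangFibres`, crux `CellParityLaw` (stmt-Parity-14109), line `section-annihilator`:
# the induction step of `KernelInduction` (skeleton v19) — the error budget (`stub_stepBudget`)

In the induction step `Q(1) ∧ Q(n) ⟹ Q(n+1)` of the kernel (`stub_inductionStep`) the total error of the
`(n+1)`-cell is the sum of

* the fibres' `Q(n)`-errors and `Q(1)`-errors summed over the primes `z < p` (two instances of
  `SumsAux.fibre_errors_sum`), each of the shape
  `FS(C, κ', A') = (u+2)·(2C·br(κ')·(VA + R) + C (log x)^{A'} (C_F (log x)^{A_F} (R + x/z) + 4x/z))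
                   + 16(u+1)·(2(VA + R) + x)/z`,
  where `br(κ) = η^κ + (log z)^{-κ} + log(2Λ)/log z` is the relative bracket of the currency, `V = V(z)`,
  `A = A(x)`, and `C_F (log x)^{A_F} (R + x/z)` is the fibres' total strong Type-I bound;
* twice the model-prime-sum error `C_M (log z)⁻¹ VA + C_M R`;
* the weighted-`P₂`-law error `kernelErr C_P κ_P A₂P` and `(u+1)` times the clip defect
  `kernelErr C_U κ_U A₂U`.

`InductionStepAux.stub_stepBudget` converts this raw total into ONE currency
`kernelErr C κ A₂ 𝒜 x z η Λ R = C·br(κ)·VA + C (log x)^{A₂} (R + x/z)` at the parent, with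
`C = (u+2)(14 + C_F)(C_n + C_1) + 160(u+1) + 4C_M + C_P + (u+1)C_U`, the smallest exponent `κ` and the
largest log-power `A₂n + A₂1 + A_F + A₂P + A₂U`. Ingredients (all elementary; `1 ≤ log z ≤ log x ≤ (u+1) log z`):
the bracket is antitone in `κ` (`bracket_mono`) and at most `4` (`bracket_le_four`: `η ≤ 1/(4u)` and
`Λ ≤ x^η` give `log(2Λ) ≤ 1 + log z`); `1/z ≤ (log z)^{-κ} ≤ br(κ)` (`inv_le_bracket`); powers of
`log x ≥ 1` are monotone. The bookkeeping itself is the abstract real inequality `budget_abstract`.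

References: E. Bombieri, RIMS Kôkyûroku 294 (1977) [BombieriRIMS1977] (the shape of the recursion); the
estimates here are bookkeeping only.
-/

noncomputable section

open scoped BigOperators Classical
open Finset Literature.NumberTheory.Sieve

namespace Summit.Parity.GeneralizedHardyLittlewood.Cruxes.CellParityLaw.SectionAnnihilator

namespace InductionStepAux

namespace stub_stepBudgetAux

/-! ## The relative bracket `br(κ) = η^κ + (log z)^{-κ} + log(2Λ)/log z` -/

/-- The bracket is antitone in the exponent: for `0 < κ ≤ κ'`, `0 ≤ η ≤ 1` and `e ≤ z` (so `log z ≥ 1`),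
`br(κ') ≤ br(κ)`. -/
theorem bracket_mono {κ κ' η Λ z : ℝ} (hκ : 0 < κ) (hκκ' : κ ≤ κ') (hη0 : 0 ≤ η) (hη1 : η ≤ 1)
    (hz : Real.exp 1 ≤ z) :
    η ^ κ' + Real.log z ^ (-κ') + Real.log (2 * Λ) / Real.log z ≤
      η ^ κ + Real.log z ^ (-κ) + Real.log (2 * Λ) / Real.log z := by
  have hz0 : 0 < z := (Real.exp_pos 1).trans_le hz
  have hlz : 1 ≤ Real.log z := by rw [Real.le_log_iff_exp_le hz0]; exact hz
  have h1 : η ^ κ' ≤ η ^ κ := by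
    rcases eq_or_lt_of_le hη0 with h | h
    · rw [← h, Real.zero_rpow (by linarith), Real.zero_rpow hκ.ne']
    · exact Real.rpow_le_rpow_of_exponent_ge h hη1 hκκ'
  have h2 : Real.log z ^ (-κ') ≤ Real.log z ^ (-κ) :=
    Real.rpow_le_rpow_of_exponent_le hlz (by linarith)
  linarith

/-- The bracket is at most `4`: `η^κ' ≤ 1`, `(log z)^{-κ'} ≤ 1`, and `log(2Λ) ≤ log 2 + η log x ≤ 1 + log z`
(as `Λ ≤ x^η`, `log x ≤ (u+1) log z`, `η(u+1) ≤ (u+1)/(4u) ≤ 1`), so `log(2Λ)/log z ≤ 2`. -/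
theorem bracket_le_four {u : ℕ} {κ' η Λ x z : ℝ} (hκ' : 0 < κ') (hu : 2 ≤ u)
    (hz : Real.exp 1 ≤ z) (hzx : z ≤ x) (hxz : Real.log x / ((u : ℝ) + 1) ≤ Real.log z)
    (hη0 : 0 ≤ η) (hηu : η ≤ 1 / (4 * (u : ℝ))) (hΛ : 1 ≤ Λ) (hΛx : Λ ≤ x ^ η) :
    η ^ κ' + Real.log z ^ (-κ') + Real.log (2 * Λ) / Real.log z ≤ 4 := by
  have hz0 : 0 < z := (Real.exp_pos 1).trans_le hz
  have hx0 : 0 < x := hz0.trans_le hzx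
  have hlz : 1 ≤ Real.log z := by rw [Real.le_log_iff_exp_le hz0]; exact hz
  have hlz0 : 0 < Real.log z := by linarith
  have hu2 : (2 : ℝ) ≤ u := by exact_mod_cast hu
  have hu1 : (0 : ℝ) < (u : ℝ) + 1 := by linarith
  have hηu1 : η * ((u : ℝ) + 1) ≤ 1 := by
    have h4u : (0 : ℝ) < 4 * u := by linarith
    calc η * ((u : ℝ) + 1) ≤ 1 / (4 * (u : ℝ)) * ((u : ℝ) + 1) := by gcongr
      _ = ((u : ℝ) + 1) / (4 * u) := by ring
      _ ≤ 1 := by rw [div_le_one h4u]; linarith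
  have hη1 : η ≤ 1 := by nlinarith
  have h1 : η ^ κ' ≤ 1 := Real.rpow_le_one hη0 hη1 hκ'.le
  have h2 : Real.log z ^ (-κ') ≤ 1 := Real.rpow_le_one_of_one_le_of_nonpos hlz (by linarith)
  have hlx : Real.log x ≤ ((u : ℝ) + 1) * Real.log z := by
    rw [div_le_iff₀ hu1] at hxz; linarith
  have hΛ0 : 0 < Λ := by linarith
  have h3 : Real.log (2 * Λ) ≤ 1 + Real.log z := by
    rw [Real.log_mul two_ne_zero hΛ0.ne']
    have hl2 : Real.log 2 ≤ 1 := by linarith [Real.log_le_sub_one_of_pos (show (0 : ℝ) < 2 by norm_num)]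
    have hlΛ : Real.log Λ ≤ η * Real.log x := by
      have := Real.log_le_log hΛ0 hΛx
      rwa [Real.log_rpow hx0] at this
    have hηlx : η * Real.log x ≤ Real.log z := by
      calc η * Real.log x ≤ η * (((u : ℝ) + 1) * Real.log z) := by gcongr
        _ = η * ((u : ℝ) + 1) * Real.log z := by ring
        _ ≤ 1 * Real.log z := by gcongr
        _ = Real.log z := one_mul _
    linarith
  have h3' : Real.log (2 * Λ) / Real.log z ≤ 2 := by
    rw [div_le_iff₀ hlz0]; linarith
  linarith

/-- `1/z ≤ br(κ)` for `κ ≤ 1`, `e ≤ z`: `1/z ≤ 1/log z = (log z)^{-1} ≤ (log z)^{-κ}` (`log z ≤ z - 1`), the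
other two summands of the bracket being nonnegative. -/
theorem inv_le_bracket {κ η Λ z : ℝ} (hκ1 : κ ≤ 1) (hη0 : 0 ≤ η) (hΛ : 1 / 2 ≤ Λ)
    (hz : Real.exp 1 ≤ z) :
    z⁻¹ ≤ η ^ κ + Real.log z ^ (-κ) + Real.log (2 * Λ) / Real.log z := by
  have hz0 : 0 < z := (Real.exp_pos 1).trans_le hz
  have hlz : 1 ≤ Real.log z := by rw [Real.le_log_iff_exp_le hz0]; exact hz
  have hlz0 : 0 < Real.log z := by linarith
  have hlzz : Real.log z ≤ z := by linarith [Real.log_le_sub_one_of_pos hz0]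
  have h1 : z⁻¹ ≤ (Real.log z)⁻¹ := inv_anti₀ hlz0 hlzz
  have h2 : (Real.log z)⁻¹ ≤ Real.log z ^ (-κ) := by
    rw [← Real.rpow_neg_one]
    exact Real.rpow_le_rpow_of_exponent_le hlz (by linarith)
  have h3 : 0 ≤ η ^ κ := Real.rpow_nonneg hη0 κ
  have h4 : 0 ≤ Real.log (2 * Λ) / Real.log z := div_nonneg (Real.log_nonneg (by linarith)) hlz0.le
  linarith

/-! ## The bookkeeping -/

/-- **Abstract bookkeeping of the fibre error sums.** With `br' ≤ br`, `br' ≤ 4`, `0 ≤ w ≤ 1`, `w ≤ br`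
(`w = 1/z`), `0 ≤ lA ≤ lN`, `1 ≤ lN`, `lA · lAF = lN` (powers of `log x`), `X4 = 4X` (`X = x/z`) and
`Q = 2(P + R)w + X` (`= (2(P+R) + x)/z`):
`(u+2)(2C br'(P+R) + C lA (C_F lAF (R+X) + X4)) + 16(u+1) Q ≤ K br P + K lN (R + X)`,
`K = (u+2)(14 + C_F)C + 80(u+1)`. -/
theorem budget_abstract {u C CF br br' P R X w lA lAF lN Q X4 : ℝ}
    (hu : 0 ≤ u) (hC : 0 ≤ C) (hCF : 0 ≤ CF) (hP : 0 ≤ P) (hR : 0 ≤ R) (hX : 0 ≤ X)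
    (hbb : br' ≤ br) (hb4 : br' ≤ 4) (hw0 : 0 ≤ w) (hw1 : w ≤ 1) (hwb : w ≤ br)
    (hlA0 : 0 ≤ lA) (hlAN : lA ≤ lN) (hlN1 : 1 ≤ lN) (hlAF : lA * lAF = lN)
    (hX4 : X4 = 4 * X) (hQ : Q = 2 * (P + R) * w + X) :
    (u + 2) * (2 * C * br' * (P + R) + C * lA * (CF * lAF * (R + X) + X4)) + 16 * (u + 1) * Q ≤
      ((u + 2) * (14 + CF) * C + 80 * (u + 1)) * br * P +
        ((u + 2) * (14 + CF) * C + 80 * (u + 1)) * lN * (R + X) := by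
  have hbr : 0 ≤ br := hw0.trans hwb
  have hRX : 0 ≤ R + X := add_nonneg hR hX
  have h1 : br' * P ≤ br * P := mul_le_mul_of_nonneg_right hbb hP
  have h2 : br' * R ≤ 4 * R := mul_le_mul_of_nonneg_right hb4 hR
  have h3 : R + X ≤ lN * (R + X) := le_mul_of_one_le_left hRX hlN1
  have h4 : lA * X ≤ lN * (R + X) := mul_le_mul hlAN (by linarith) hX (hlA0.trans hlAN)
  have h5 : lA * (CF * lAF * (R + X)) = CF * (lN * (R + X)) := by rw [← hlAF]; ring
  have h6 : 0 ≤ br * P := mul_nonneg hbr hP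
  have h7 : 0 ≤ lN * (R + X) := mul_nonneg (zero_le_one.trans hlN1) hRX
  have h8 : 0 ≤ CF * (br * P) := mul_nonneg hCF h6
  -- the fibre part, per unit of `C`
  have inner1 : 2 * br' * (P + R) + lA * (CF * lAF * (R + X) + X4) ≤
      (14 + CF) * (br * P) + (14 + CF) * (lN * (R + X)) := by
    rw [hX4]; linarith
  -- the junk part
  have g1 : P * w ≤ br * P := by nlinarith [mul_le_mul_of_nonneg_left hwb hP]
  have g2 : R * w ≤ R := mul_le_of_le_one_right hR hw1
  have inner2 : Q ≤ 5 * (br * P) + 5 * (lN * (R + X)) := by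
    rw [hQ]; nlinarith
  have hu2 : 0 ≤ u + 2 := by linarith
  have hu16 : 0 ≤ 16 * (u + 1) := by linarith
  have p1 := mul_le_mul_of_nonneg_left (mul_le_mul_of_nonneg_left inner1 hC) hu2
  have p2 := mul_le_mul_of_nonneg_left inner2 hu16
  nlinarith [p1, p2]

/-- **The fibre error sums in the currency**: for `0 ≤ C`, `0 < κ ≤ κ'`, `κ ≤ 1` and the ranges of the step,
`FS(C, κ', A') ≤ kernelErr ((u+2)(14 + C_F) C + 80(u+1)) κ (A' + A_F) 𝒜 x z η Λ R`. -/
theorem fibreSum_le {u : ℕ} {𝒜 : SieveSequence} {x z η Λ R C CF κ κ' : ℝ} {A' AF : ℕ}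
    (hC : 0 ≤ C) (hCF : 0 ≤ CF) (hκ : 0 < κ) (hκκ' : κ ≤ κ') (hκ1 : κ ≤ 1)
    (hz : Real.exp 1 ≤ z) (hzx : z ≤ x) (hxz : Real.log x / ((u : ℝ) + 1) ≤ Real.log z)
    (hη0 : 0 ≤ η) (hηu : η ≤ 1 / (4 * (u : ℝ))) (hu : 2 ≤ u) (hΛ : 1 ≤ Λ) (hΛx : Λ ≤ x ^ η)
    (hV : 0 ≤ 𝒜.densityProduct (primesProdBelow z)) (hA : 0 ≤ 𝒜.size x) (hR : 0 ≤ R) :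
    ((u : ℝ) + 2) * (2 * C * (η ^ κ' + Real.log z ^ (-κ') + Real.log (2 * Λ) / Real.log z) *
          (𝒜.densityProduct (primesProdBelow z) * 𝒜.size x + R) +
        C * Real.log x ^ A' * (CF * Real.log x ^ AF * (R + x / z) + 4 * x / z)) +
      16 * ((u : ℝ) + 1) * ((2 * (𝒜.densityProduct (primesProdBelow z) * 𝒜.size x + R) + x) / z) ≤
    kernelErr (((u : ℝ) + 2) * (14 + CF) * C + 80 * ((u : ℝ) + 1)) κ (A' + AF) 𝒜 x z η Λ R := by
  have hz0 : 0 < z := (Real.exp_pos 1).trans_le hz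
  have hx0 : 0 < x := hz0.trans_le hzx
  have hz1 : 1 ≤ z := by linarith [Real.add_one_le_exp (1 : ℝ)]
  have hlx1 : 1 ≤ Real.log x := by rw [Real.le_log_iff_exp_le hx0]; exact hz.trans hzx
  have hu2 : (2 : ℝ) ≤ u := by exact_mod_cast hu
  have hη1 : η ≤ 1 := by
    have h4u : (0 : ℝ) < 4 * u := by linarith
    have : 1 / (4 * (u : ℝ)) ≤ 1 := by rw [div_le_one h4u]; linarith
    linarith
  have hΛ2 : 1 / 2 ≤ Λ := by linarith
  -- the data of `budget_abstract`
  have hu0 : (0 : ℝ) ≤ u := by linarith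
  have hP : 0 ≤ 𝒜.densityProduct (primesProdBelow z) * 𝒜.size x := mul_nonneg hV hA
  have hX : 0 ≤ x / z := div_nonneg hx0.le hz0.le
  have hbb := bracket_mono (Λ := Λ) hκ hκκ' hη0 hη1 hz
  have hκ' : 0 < κ' := hκ.trans_le hκκ'
  have hb4 := bracket_le_four hκ' hu hz hzx hxz hη0 hηu hΛ hΛx
  have hw0 : 0 ≤ z⁻¹ := inv_nonneg.mpr hz0.le
  have hw1 : z⁻¹ ≤ 1 := inv_le_one_of_one_le₀ hz1
  have hwb := inv_le_bracket hκ1 hη0 hΛ2 hz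
  have hlA0 : 0 ≤ Real.log x ^ A' := pow_nonneg (zero_le_one.trans hlx1) _
  have hlAN : Real.log x ^ A' ≤ Real.log x ^ (A' + AF) := pow_le_pow_right₀ hlx1 (Nat.le_add_right _ _)
  have hlN1 : 1 ≤ Real.log x ^ (A' + AF) := one_le_pow₀ hlx1
  have hlAF : Real.log x ^ A' * Real.log x ^ AF = Real.log x ^ (A' + AF) := (pow_add _ _ _).symm
  have hX4 : 4 * x / z = 4 * (x / z) := mul_div_assoc _ _ _
  have hQ : (2 * (𝒜.densityProduct (primesProdBelow z) * 𝒜.size x + R) + x) / z =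
      2 * (𝒜.densityProduct (primesProdBelow z) * 𝒜.size x + R) * z⁻¹ + x / z := by
    rw [add_div, div_eq_mul_inv (2 * _)]
  unfold kernelErr
  exact budget_abstract hu0 hC hCF hP hR hX hbb hb4 hw0 hw1 hwb hlA0 hlAN hlN1 hlAF hX4 hQ

/-- **The model-prime-sum error in the currency**: `2 (C_M (log z)⁻¹ VA + C_M R) ≤ kernelErr (4 C_M) κ 0`
(`(log z)⁻¹ VA ≤ kernelErr 1 κ 0` and `R ≤ R + x/z ≤ kernelErr 1 κ 0`, `KernelErrAux.raw_le_kernelErr`). -/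
theorem modelErr_le {CM κ : ℝ} {𝒜 : SieveSequence} {x z η Λ R : ℝ} (hCM : 0 ≤ CM) (hκ : 0 < κ)
    (hκ1 : κ ≤ 1) (hη0 : 0 ≤ η) (hη1 : η ≤ 1) (hΛ : 1 / 2 ≤ Λ) (hz : Real.exp 1 ≤ z)
    (hx : Real.exp 1 ≤ x) (hV : 0 ≤ 𝒜.densityProduct (primesProdBelow z)) (hAs : 0 ≤ 𝒜.size x)
    (hR : 0 ≤ R) :
    2 * (CM * (Real.log z)⁻¹ * (𝒜.densityProduct (primesProdBelow z) * 𝒜.size x) + CM * R) ≤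
      kernelErr (4 * CM) κ 0 𝒜 x z η Λ R := by
  obtain ⟨-, h2, -, h4⟩ := KernelErrAux.raw_le_kernelErr hκ hκ1 hη0 hη1 hΛ hz hx hV hAs hR
  have hz0 : 0 < z := (Real.exp_pos 1).trans_le hz
  have hx0 : 0 < x := (Real.exp_pos 1).trans_le hx
  have hxz : 0 ≤ x / z := div_nonneg hx0.le hz0.le
  have hR' : R ≤ kernelErr 1 κ 0 𝒜 x z η Λ R := by linarith
  have e : kernelErr (4 * CM) κ 0 𝒜 x z η Λ R = 4 * CM * kernelErr 1 κ 0 𝒜 x z η Λ R := by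
    rw [KernelErrAux.kernelErr_smul, mul_one]
  have e1 := mul_le_mul_of_nonneg_left h2 hCM
  have e2 := mul_le_mul_of_nonneg_left hR' hCM
  rw [e]
  linarith

end stub_stepBudgetAux

open stub_stepBudgetAux in
/-- **`InductionStepAux.stub_stepBudget`** (registered sub-goal S3 of `stub_inductionStep`, skeleton v19, line
`section-annihilator`): the error budget of the induction step. The raw total error of the `(n+1)`-cell — the
fibres' `Q(n)`- and `Q(1)`-errors summed over the primes (two blocks `FS(C_n, κ_n, A₂n)`, `FS(C_1, κ_1, A₂1)`),
twice the model-prime-sum error `C_M (log z)⁻¹ VA + C_M R`, the weighted-`P₂`-law error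
`kernelErr C_P κ_P A₂P` and `(u+1)` clip defects `kernelErr C_U κ_U A₂U` — is at most ONE currency
`kernelErr ((u+2)(14 + C_F)(C_n + C_1) + 160(u+1) + 4 C_M + C_P + (u+1) C_U) κ (A₂n + A₂1 + A_F + A₂P + A₂U)`
at the parent (`κ` the least exponent). Pure real bookkeeping: `fibreSum_le` twice, `modelErr_le`,
`KernelErrAux.kernelErr_mono`/`kernelErr_smul`/`kernelErr_add`. -/
theorem stub_stepBudget : ∀ (u : ℕ) (𝒜 : SieveSequence) (x z η Λ R Cn C1 CF CM CP CU κ κn κ1 κP κU : ℝ)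
    (A₂n A₂1 AF A₂P A₂U : ℕ),
    2 ≤ u → 0 ≤ Cn → 0 ≤ C1 → 0 ≤ CF → 0 ≤ CM → 0 ≤ CP → 0 ≤ CU →
    0 < κ → κ ≤ κn → κ ≤ κ1 → κ ≤ κP → κ ≤ κU → κ ≤ 1 →
    Real.exp 1 ≤ z → z ≤ x → Real.log x / ((u : ℝ) + 1) ≤ Real.log z →
    0 ≤ η → η ≤ 1 / (4 * (u : ℝ)) → 1 ≤ Λ → Λ ≤ x ^ η →
    0 ≤ 𝒜.densityProduct (primesProdBelow z) → 0 ≤ 𝒜.size x → 0 ≤ R →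
    (((u : ℝ) + 2) * (2 * Cn * (η ^ κn + Real.log z ^ (-κn) + Real.log (2 * Λ) / Real.log z) *
          (𝒜.densityProduct (primesProdBelow z) * 𝒜.size x + R) +
        Cn * Real.log x ^ A₂n * (CF * Real.log x ^ AF * (R + x / z) + 4 * x / z)) +
      16 * ((u : ℝ) + 1) * ((2 * (𝒜.densityProduct (primesProdBelow z) * 𝒜.size x + R) + x) / z)) +
    (((u : ℝ) + 2) * (2 * C1 * (η ^ κ1 + Real.log z ^ (-κ1) + Real.log (2 * Λ) / Real.log z) *
          (𝒜.densityProduct (primesProdBelow z) * 𝒜.size x + R) +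
        C1 * Real.log x ^ A₂1 * (CF * Real.log x ^ AF * (R + x / z) + 4 * x / z)) +
      16 * ((u : ℝ) + 1) * ((2 * (𝒜.densityProduct (primesProdBelow z) * 𝒜.size x + R) + x) / z)) +
    2 * (CM * (Real.log z)⁻¹ * (𝒜.densityProduct (primesProdBelow z) * 𝒜.size x) + CM * R) +
    kernelErr CP κP A₂P 𝒜 x z η Λ R + ((u : ℝ) + 1) * kernelErr CU κU A₂U 𝒜 x z η Λ R ≤
      kernelErr (((u : ℝ) + 2) * (14 + CF) * (Cn + C1) + 160 * ((u : ℝ) + 1) + 4 * CM + CP +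
          ((u : ℝ) + 1) * CU) κ (A₂n + A₂1 + AF + A₂P + A₂U) 𝒜 x z η Λ R := by
  intro u 𝒜 x z η Λ R Cn C1 CF CM CP CU κ κn κ1 κP κU A₂n A₂1 AF A₂P A₂U hu hCn hC1 hCF hCM hCP hCU
    hκ hκn hκ1 hκP hκU hκ1' hz hzx hxz hη0 hηu hΛ hΛx hV hA hR
  -- ranges
  have hx : Real.exp 1 ≤ x := hz.trans hzx
  have hu2 : (2 : ℝ) ≤ u := by exact_mod_cast hu
  have hη1 : η ≤ 1 := by
    have h4u : (0 : ℝ) < 4 * u := by linarith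
    have : 1 / (4 * (u : ℝ)) ≤ 1 := by rw [div_le_one h4u]; linarith
    linarith
  have hΛ2 : 1 / 2 ≤ Λ := by linarith
  -- raising every piece to the exponent `κ` and the log-power `N`
  have mono : ∀ {C κ' : ℝ} {A' : ℕ}, 0 ≤ C → κ ≤ κ' → A' ≤ A₂n + A₂1 + AF + A₂P + A₂U →
      kernelErr C κ' A' 𝒜 x z η Λ R ≤ kernelErr C κ (A₂n + A₂1 + AF + A₂P + A₂U) 𝒜 x z η Λ R :=
    fun hC hκκ' hA' => KernelErrAux.kernelErr_mono hC le_rfl hκ hκκ' hA' hη0 hη1 hΛ2 hz hx hV hA hR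
  have hK1 : 0 ≤ ((u : ℝ) + 2) * (14 + CF) * Cn + 80 * ((u : ℝ) + 1) := by positivity
  have hK2 : 0 ≤ ((u : ℝ) + 2) * (14 + CF) * C1 + 80 * ((u : ℝ) + 1) := by positivity
  have hF1 := (fibreSum_le (A' := A₂n) (AF := AF) hCn hCF hκ hκn hκ1' hz hzx hxz hη0 hηu hu hΛ hΛx hV hA
    hR).trans (mono hK1 le_rfl (by omega))
  have hF2 := (fibreSum_le (A' := A₂1) (AF := AF) hC1 hCF hκ hκ1 hκ1' hz hzx hxz hη0 hηu hu hΛ hΛx hV hA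
    hR).trans (mono hK2 le_rfl (by omega))
  have hM := (modelErr_le hCM hκ hκ1' hη0 hη1 hΛ2 hz hx hV hA hR).trans
    (mono (by positivity) le_rfl (Nat.zero_le _))
  have hP := mono hCP hκP (show A₂P ≤ A₂n + A₂1 + AF + A₂P + A₂U by omega)
  have hU : ((u : ℝ) + 1) * kernelErr CU κU A₂U 𝒜 x z η Λ R ≤
      kernelErr (((u : ℝ) + 1) * CU) κ (A₂n + A₂1 + AF + A₂P + A₂U) 𝒜 x z η Λ R := by
    rw [KernelErrAux.kernelErr_smul]; exact mono (by positivity) hκU (by omega)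
  have hsum : kernelErr (((u : ℝ) + 2) * (14 + CF) * Cn + 80 * ((u : ℝ) + 1)) κ
        (A₂n + A₂1 + AF + A₂P + A₂U) 𝒜 x z η Λ R +
      kernelErr (((u : ℝ) + 2) * (14 + CF) * C1 + 80 * ((u : ℝ) + 1)) κ
        (A₂n + A₂1 + AF + A₂P + A₂U) 𝒜 x z η Λ R +
      kernelErr (4 * CM) κ (A₂n + A₂1 + AF + A₂P + A₂U) 𝒜 x z η Λ R +
      kernelErr CP κ (A₂n + A₂1 + AF + A₂P + A₂U) 𝒜 x z η Λ R +
      kernelErr (((u : ℝ) + 1) * CU) κ (A₂n + A₂1 + AF + A₂P + A₂U) 𝒜 x z η Λ R =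
      kernelErr (((u : ℝ) + 2) * (14 + CF) * (Cn + C1) + 160 * ((u : ℝ) + 1) + 4 * CM + CP +
          ((u : ℝ) + 1) * CU) κ (A₂n + A₂1 + AF + A₂P + A₂U) 𝒜 x z η Λ R := by
    rw [KernelErrAux.kernelErr_add, KernelErrAux.kernelErr_add, KernelErrAux.kernelErr_add,
      KernelErrAux.kernelErr_add]
    congr 1; ring
  calc _ ≤ _ := add_le_add (add_le_add (add_le_add (add_le_add hF1 hF2) hM) hP) hU
    _ = _ := hsum

end InductionStepAux

end Summit.Parity.GeneralizedHardyLittlewood.Cruxes.CellParityLaw.SectionAnnihilator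

end
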